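import Literature.Probability.Percolation.Z2PivotalJointSubseqLimit
import Literature.Probability.Distributions.RieszMarkovKernelMeasurable
import Literature.Probability.Distributions.AntitoneKernelVersionAE
import Literature.Probability.Distributions.JointLawApproximation
import HarnessLib

/-!
# Joint limits of a bond-`ℤ²` configuration with its pivotal measures: from a test family to `C_c`

Topic `Literature/Probability/Percolation`; sequel of `Z2PivotalJointSubseqLimit.lean` (the
tightness / Prokhorov node of the Garban–Pete–Schramm joint limit
`(ω_δ, (μ^{εⱼ}_δ)ⱼ) ⇒ (S, (M εⱼ S)ⱼ)` of bond percolation on `δℤ²` at `p = ½` with its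
isometry-averaged `ε`-important measures `μ^ε_δ = z2PivotalMeasure ε δ`), written for the stub
`stub_jointKernelLimit` of crux `FlipErgodicityZ2` (route
`Summits/CriticalPhenomena/CardyFormulaZ2/Theses/CardyMeckeFlip`).  No named fact is introduced.

**The extension node** (`tendsto_jointLaw_z2PivotalMeasure_of_testFamily`).  Suppose that along
a mesh sequence `δ_k → 0⁺` the configuration `ω_{δ_k} ∈ ℋ` together with the integrals
`⟨μ^ε_{δ_k}, g⟩` of the members `g` of a dominated-dense test family `𝓓 ⊆ C_c(ℂ, ℝ)` (every
compact `K` has a cutoff `χ ∈ 𝓓`, `0 ≤ χ ≤ 1`, `χ = 1` on `K`, with every `f ∈ C_c` supported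
in `K` within `η χ` of `𝓓` for all `η > 0`), at the cutoffs `ε` of a set `A`, converge jointly in
law to `(S, (∫ g d(M ε S))_{(ε, g)})`, `S ∼ μ`, for measurable kernels `M ε` finite on compact
sets and locally `μ`-integrable (`ε ∈ A`), and assume the uniform second moments
`sup_{δ ≤ δ₀} E[⟨μ^ε_δ, |φ|⟩²] < ∞`.  Then for every finite family of cutoffs `εⱼ ∈ A` and
test functions `φⱼ ∈ C_c(ℂ)` and every bounded continuous `F` on `ℋ × ℝ^m`,
`E F(ω_{δ_k}, (⟨μ^{εⱼ}_{δ_k}, φⱼ⟩)ⱼ) → ∫ F(S, (∫ φⱼ d(M εⱼ S))ⱼ) dμ(S)`.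

Proof: dominated approximants `g ∈ 𝓓`, `|φ - g| ≤ χ / (n + 1)`, give
`|⟨m, φ⟩ - ⟨m, g⟩| ≤ ⟨m, χ⟩ / (n + 1)` for every measure `m` finite on compacts
(`abs_integral_sub_le_of_abs_sub_le`), on the lattice (`E⟨μ^ε_{δ_k}, χ⟩ ≤ C + 1` uniformly in
`k`, from the second moments) and in the limit (`∫∫ χ d(M ε S) dμ < ∞`, local integrability);
conclude by the two-sided approximation lemma `tendsto_pair_of_approx`
(`JointLawApproximation.lean`).

## References

* C. Garban, G. Pete, O. Schramm, *Pivotal, cluster and interface measures for critical planar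
  percolation*, JAMS 26 (2013), arXiv:1008.1378, Thm. 4.3, §4.7.
* P. Billingsley, *Convergence of Probability Measures*, 2nd ed. (1999), Thm. 3.2.
-/

noncomputable section

open Set Filter Metric Function
open _root_.MeasureTheory _root_.Topology _root_.TopologicalSpace
open scoped ENNReal BoundedContinuousFunction CompactlySupported

namespace Literature.Probability.Percolation

open QuadCrossing LatticeModels Literature.Probability.Distributions

/-! ### Lattice side: first moments from second moments -/

/-- **Uniform first moments along a mesh sequence.**  From the uniform second moments
`sup_{0 < δ ≤ δ₀} E[⟨μ^ε_δ, |φ|⟩²] < ∞` and `δ_k → 0⁺`: for `χ ∈ C_c(ℂ)`, `χ ≥ 0`, there is `B`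
with `E⟨μ^ε_{δ_k}, χ⟩ ≤ B` for all `k` (`t ≤ t² + 1`). [folklore] -/
theorem exists_integral_integral_z2PivotalMeasure_le
    (hmom : ∀ ε : ℝ, 0 < ε → ∀ φ : ℂ → ℝ, Continuous φ → HasCompactSupport φ →
      ∃ C δ₀ : ℝ, 0 < δ₀ ∧ ∀ δ : ℝ, 0 < δ → δ ≤ δ₀ →
        ∫ ω, (∫ x, |φ x| ∂(z2PivotalMeasure ε δ ω)) ^ 2 ∂(bondPercolation (zdGraph 2) half) ≤ C)
    {δs : ℕ → ℝ} (hpos : ∀ k, 0 < δs k) (h0 : Tendsto δs atTop (𝓝 0)) {ε : ℝ} (hε : 0 < ε)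
    {χ : ℂ → ℝ} (hχ : Continuous χ) (hχc : HasCompactSupport χ) (hχ0 : ∀ x, 0 ≤ χ x) :
    ∃ B : ℝ, ∀ k, ∫ ω, (∫ x, χ x ∂(z2PivotalMeasure ε (δs k) ω))
      ∂(bondPercolation (zdGraph 2) half) ≤ B := by
  obtain ⟨C, δ₀, hδ₀, hC⟩ := hmom ε hε χ hχ hχc
  obtain ⟨C', hC'⟩ := exists_forall_apply_le_of_tendsto_zero hpos h0
    (fun δ => ∫ ω, (∫ x, |χ x| ∂(z2PivotalMeasure ε δ ω)) ^ 2 ∂(bondPercolation (zdGraph 2) half))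
    hδ₀ hC
  have habs : ∀ x, |χ x| = χ x := fun x => abs_of_nonneg (hχ0 x)
  refine ⟨C' + 1, fun k => ?_⟩
  haveI : IsProbabilityMeasure (bondPercolation (zdGraph 2) half) := by
    unfold bondPercolation; infer_instance
  have h2 := hC' k
  simp only [habs] at h2
  calc ∫ ω, (∫ x, χ x ∂(z2PivotalMeasure ε (δs k) ω)) ∂(bondPercolation (zdGraph 2) half)
      ≤ ∫ ω, ((∫ x, χ x ∂(z2PivotalMeasure ε (δs k) ω)) ^ 2 + 1)
          ∂(bondPercolation (zdGraph 2) half) :=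
        integral_mono (integrable_integral_z2PivotalMeasure hε (hpos k) hχ hχc)
          ((integrable_sq_integral_z2PivotalMeasure hε (hpos k) hχ hχc).add (integrable_const 1))
          fun ω => by nlinarith [sq_nonneg ((∫ x, χ x ∂(z2PivotalMeasure ε (δs k) ω)) - 1)]
    _ = ∫ ω, (∫ x, χ x ∂(z2PivotalMeasure ε (δs k) ω)) ^ 2 ∂(bondPercolation (zdGraph 2) half) + 1 := by
        rw [integral_add (integrable_sq_integral_z2PivotalMeasure hε (hpos k) hχ hχc)
          (integrable_const 1), integral_const, smul_eq_mul, mul_one, probReal_univ]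
    _ ≤ C' + 1 := by linarith

/-! ### Limit side: integrability of `S ↦ ∫ χ d(M S)` from local integrability -/

/-- For a measurable kernel `M` on `ℂ`, finite on compacts and with locally `μ`-integrable
masses, and `χ ∈ C_c(ℂ)` with values in `[0, 1]`, the function `S ↦ ∫ χ d(M S)` is
`μ`-integrable (it is measurable, non-negative, and `∫ χ d(M S) ≤ M S (closedBall 0 r)` for a
ball containing the support of `χ`). [folklore] -/
theorem integrable_integral_kernel_of_lintegral_closedBall_lt_top {X : Type*} [MeasurableSpace X]
    {μ : Measure X} {M : X → Measure ℂ} (hM : Measurable M)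
    (hMfin : ∀ S, IsFiniteMeasureOnCompacts (M S))
    (hint : ∀ r : ℝ, ∫⁻ S, M S (closedBall 0 r) ∂μ < ⊤) (χ : C_c(ℂ, ℝ))
    (hχ01 : ∀ x, χ x ∈ Icc (0 : ℝ) 1) :
    Integrable (fun S => ∫ x, χ x ∂(M S)) μ := by
  have hm : Measurable fun S => ∫ x, χ x ∂(M S) :=
    measurable_integral_of_measurable_measure hM χ.continuous.stronglyMeasurable
  have h0 : ∀ S, 0 ≤ ∫ x, χ x ∂(M S) := fun S => integral_nonneg fun x => (hχ01 x).1
  obtain ⟨r, hr⟩ := χ.hasCompactSupport.isCompact.isBounded.subset_closedBall (0 : ℂ)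
  refine ⟨hm.aestronglyMeasurable, (hasFiniteIntegral_iff_ofReal (ae_of_all _ h0)).2 ?_⟩
  refine lt_of_le_of_lt (lintegral_mono fun S => ?_) (hint r)
  haveI := hMfin S
  rw [ofReal_integral_eq_lintegral_ofReal χ.integrable (ae_of_all _ fun x => (hχ01 x).1)]
  exact (lintegral_ofReal_le_measure_tsupport (M S) hχ01).trans (measure_mono hr)

/-! ### The extension to all test functions -/

/-- **From a dominated-dense test family to all of `C_c(ℂ)`** (extension node of the joint
limit of a bond-`ℤ²` configuration with its averaged pivotal measures).  Let `δ_k → 0⁺`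
(`δ_k > 0`), let the uniform second moments `sup_{0 < δ ≤ δ₀} E[⟨μ^ε_δ, |φ|⟩²] < ∞` hold for all
`ε > 0`, `φ ∈ C_c(ℂ)`, let `𝓓 ⊆ C_c(ℂ, ℝ)` be dominated-dense, `A` a set of positive cutoffs,
and `M ε : ℋ → Measure ℂ` measurable kernels, finite on compact sets, locally `μ`-integrable for
`ε ∈ A` (`μ` a probability law on `ℋ = QuadConfig univ`), such that
`(ω_{δ_k}, (⟨μ^ε_{δ_k}, g⟩)_{(ε, g) ∈ A × 𝓓}) ⇒ (S, (∫ g d(M ε S))_{(ε, g)})` jointly (bounded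
continuous test functions on `ℋ × ℝ^{A × 𝓓}`, `S ∼ μ`).  Then for all finite families `εⱼ ∈ A`,
`φⱼ ∈ C_c(ℂ)` and bounded continuous `F` on `ℋ × ℝ^m`,
`E F(ω_{δ_k}, (⟨μ^{εⱼ}_{δ_k}, φⱼ⟩)ⱼ) → ∫ F(S, (∫ φⱼ d(M εⱼ S))ⱼ) dμ(S)`. [folklore] -/
theorem tendsto_jointLaw_z2PivotalMeasure_of_testFamily
    (hmom : ∀ ε : ℝ, 0 < ε → ∀ φ : ℂ → ℝ, Continuous φ → HasCompactSupport φ →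
      ∃ C δ₀ : ℝ, 0 < δ₀ ∧ ∀ δ : ℝ, 0 < δ → δ ≤ δ₀ →
        ∫ ω, (∫ x, |φ x| ∂(z2PivotalMeasure ε δ ω)) ^ 2 ∂(bondPercolation (zdGraph 2) half) ≤ C)
    (μ : Measure (QuadConfig (univ : Set ℂ))) [IsProbabilityMeasure μ] {δs : ℕ → ℝ}
    (hpos : ∀ k, 0 < δs k) (h0 : Tendsto δs atTop (𝓝 0)) {𝓓 : Set C_c(ℂ, ℝ)}
    (hdense : ∀ K : Set ℂ, IsCompact K → ∃ χ ∈ 𝓓, (∀ x, χ x ∈ Icc (0 : ℝ) 1) ∧ (∀ x ∈ K, χ x = 1) ∧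
      ∀ f : C_c(ℂ, ℝ), support f ⊆ K → ∀ η : ℝ, 0 < η → ∃ g ∈ 𝓓, ∀ x, |f x - g x| ≤ η * χ x)
    {A : Set ℝ} (hApos : ∀ ε ∈ A, 0 < ε) {M : ℝ → QuadConfig (univ : Set ℂ) → Measure ℂ}
    (hMm : ∀ ε, Measurable (M ε)) (hMfin : ∀ ε S, IsFiniteMeasureOnCompacts (M ε S))
    (hMint : ∀ ε ∈ A, ∀ r : ℝ, ∫⁻ S, M ε S (closedBall 0 r) ∂μ < ⊤)
    (hG : ∀ G : (QuadConfig (univ : Set ℂ) × (A × 𝓓 → ℝ)) →ᵇ ℝ,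
      Tendsto (fun k => ∫ ω, G (z2QuadConfig (univ : Set ℂ) (δs k) ω,
          fun p => ∫ x, (p.2 : C_c(ℂ, ℝ)) x ∂(z2PivotalMeasure (p.1 : ℝ) (δs k) ω))
        ∂(bondPercolation (zdGraph 2) half)) atTop
        (𝓝 (∫ S, G (S, fun p => ∫ x, (p.2 : C_c(ℂ, ℝ)) x ∂(M (p.1 : ℝ) S)) ∂μ)))
    {m : ℕ} {εs : Fin m → ℝ} (hεs : ∀ j, εs j ∈ A) {φ : Fin m → ℂ → ℝ}
    (hφ : ∀ j, Continuous (φ j)) (hφc : ∀ j, HasCompactSupport (φ j))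
    (F : (QuadConfig (univ : Set ℂ) × (Fin m → ℝ)) →ᵇ ℝ) :
    Tendsto (fun k => ∫ ω, F (z2QuadConfig (univ : Set ℂ) (δs k) ω,
        fun j => ∫ x, φ j x ∂(z2PivotalMeasure (εs j) (δs k) ω)) ∂(bondPercolation (zdGraph 2) half))
      atTop (𝓝 (∫ S, F (S, fun j => ∫ x, φ j x ∂(M (εs j) S)) ∂μ)) := by
  classical
  -- `ℋ` is compact metrisable (Schramm–Smirnov Thm. 1.4); `P_½` is a probability measure
  haveI : T2Space (QuadConfig (univ : Set ℂ)) :=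
    (SchrammSmirnov2011_thm_1_4_holds univ isOpen_univ univ_nonempty).1.2.2
  haveI : TopologicalSpace.MetrizableSpace (QuadConfig (univ : Set ℂ)) :=
    (SchrammSmirnov2011_thm_1_4_holds univ isOpen_univ univ_nonempty).1.2.1
  haveI : IsProbabilityMeasure (bondPercolation (zdGraph 2) half) := by
    unfold bondPercolation; infer_instance
  have hε : ∀ j, 0 < εs j := fun j => hApos _ (hεs j)
  -- the test functions as elements of `C_c`, their cutoffs and dominated approximants
  set φc : Fin m → C_c(ℂ, ℝ) := fun j => ⟨⟨φ j, hφ j⟩, hφc j⟩ with hφcdef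
  have hφcφ : ∀ j x, φc j x = φ j x := fun j x => rfl
  have hcut : ∀ j, ∃ χ ∈ 𝓓, (∀ x, χ x ∈ Icc (0 : ℝ) 1) ∧
      ∀ η : ℝ, 0 < η → ∃ g ∈ 𝓓, ∀ x, |φc j x - g x| ≤ η * χ x := fun j => by
    obtain ⟨χ, hχ, h01, -, happrox⟩ := hdense (tsupport (φc j)) (φc j).hasCompactSupport
    exact ⟨χ, hχ, h01, fun η hη => happrox (φc j) (subset_tsupport _) η hη⟩
  choose χ hχ hχ01 happrox using hcut
  choose g hg hφg using fun j (n : ℕ) => happrox j (1 / ((n : ℝ) + 1)) (by positivity)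
  -- the bounds: lattice first moments and limit means of the cutoffs
  choose Bl hBl using fun j => exists_integral_integral_z2PivotalMeasure_le hmom hpos h0 (hε j)
    (χ j).continuous (χ j).hasCompactSupport fun x => (hχ01 j x).1
  have hZ : ∀ j, Integrable (fun S => ∫ x, χ j x ∂(M (εs j) S)) μ := fun j =>
    integrable_integral_kernel_of_lintegral_closedBall_lt_top (hMm _) (hMfin _)
      (hMint _ (hεs j)) (χ j) (hχ01 j)
  set B : ℝ := ∑ j, (Bl j + ∫ S, ∫ x, χ j x ∂(M (εs j) S) ∂μ) with hB
  have hBl0 : ∀ j, 0 ≤ Bl j := fun j => le_trans (integral_nonneg fun ω =>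
    integral_nonneg fun x => (hχ01 j x).1) (hBl j 0)
  have hBm0 : ∀ j, 0 ≤ ∫ S, ∫ x, χ j x ∂(M (εs j) S) ∂μ := fun j =>
    integral_nonneg fun S => integral_nonneg fun x => (hχ01 j x).1
  -- the approximation lemma
  refine tendsto_pair_of_approx (P := bondPercolation (zdGraph 2) half) (μ := μ)
    (X := fun k => z2QuadConfig (univ : Set ℂ) (δs k))
    (v := fun k ω j => ∫ x, φ j x ∂(z2PivotalMeasure (εs j) (δs k) ω))
    (w := fun S j => ∫ x, φ j x ∂(M (εs j) S))
    (va := fun n k ω j => ∫ x, g j n x ∂(z2PivotalMeasure (εs j) (δs k) ω))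
    (wa := fun n S j => ∫ x, g j n x ∂(M (εs j) S))
    (fun k => measurable_z2QuadConfig isOpen_univ (hpos k))
    (fun k => measurable_pi_lambda _ fun j =>
      measurable_integral_z2PivotalMeasure (hε j) (hpos k) (hφ j) (hφc j))
    (measurable_pi_lambda _ fun j =>
      measurable_integral_of_measurable_measure (hMm _) (hφ j).stronglyMeasurable)
    (fun n k => measurable_pi_lambda _ fun j =>
      measurable_integral_z2PivotalMeasure (hε j) (hpos k) (g j n).continuous (g j n).hasCompactSupport)
    (fun n => measurable_pi_lambda _ fun j =>
      measurable_integral_of_measurable_measure (hMm _) (g j n).continuous.stronglyMeasurable)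
    (fun n G => ?_) (b := fun n => 1 / ((n : ℝ) + 1) * B) ?_ (fun n η hη => ?_) (fun n => ?_) F
  · -- joint convergence of the approximants: test `G ∘ (S, x ↦ (x (εⱼ, gⱼₙ))ⱼ)`
    have h := hG (G.compContinuous
      ⟨fun p : QuadConfig (univ : Set ℂ) × (A × 𝓓 → ℝ) =>
        (p.1, fun j => p.2 (⟨εs j, hεs j⟩, ⟨g j n, hg j n⟩)), by fun_prop⟩)
    simpa only [BoundedContinuousFunction.compContinuous_apply, ContinuousMap.coe_mk] using h
  · -- `b n → 0`
    have h := (tendsto_one_div_add_atTop_nhds_zero_nat (𝕜 := ℝ)).mul_const B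
    rwa [zero_mul] at h
  · -- lattice-side approximation, uniformly in `k`
    refine Eventually.of_forall fun k => ?_
    have hYi : ∀ j, Integrable (fun ω => ∫ x, χ j x ∂(z2PivotalMeasure (εs j) (δs k) ω))
        (bondPercolation (zdGraph 2) half) := fun j =>
      integrable_integral_z2PivotalMeasure (hε j) (hpos k) (χ j).continuous (χ j).hasCompactSupport
    have hpt : ∀ ω, min 1 (dist (fun j => ∫ x, φ j x ∂(z2PivotalMeasure (εs j) (δs k) ω))
        (fun j => ∫ x, g j n x ∂(z2PivotalMeasure (εs j) (δs k) ω))) ≤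
        1 / ((n : ℝ) + 1) * ∑ j, ∫ x, χ j x ∂(z2PivotalMeasure (εs j) (δs k) ω) := fun ω => by
      haveI : ∀ j, IsFiniteMeasureOnCompacts (z2PivotalMeasure (εs j) (δs k) ω) := fun j =>
        isFiniteMeasureOnCompacts_z2PivotalMeasure _ (hpos k) ω
      have hj : ∀ j, |∫ x, φ j x ∂(z2PivotalMeasure (εs j) (δs k) ω) -
          ∫ x, g j n x ∂(z2PivotalMeasure (εs j) (δs k) ω)| ≤
          1 / ((n : ℝ) + 1) * ∫ x, χ j x ∂(z2PivotalMeasure (εs j) (δs k) ω) := fun j =>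
        abs_integral_sub_le_of_abs_sub_le _ (φc j) (g j n) (χ j) (hφg j n)
      have hsum0 : ∀ j, 0 ≤ 1 / ((n : ℝ) + 1) * ∫ x, χ j x ∂(z2PivotalMeasure (εs j) (δs k) ω) :=
        fun j => mul_nonneg (by positivity) (integral_nonneg fun x => (hχ01 j x).1)
      refine (min_le_right _ _).trans ?_
      rw [Finset.mul_sum]
      refine (dist_pi_le_iff (Finset.sum_nonneg fun j _ => hsum0 j)).2 fun j => ?_
      rw [Real.dist_eq]
      exact (hj j).trans (Finset.single_le_sum (fun i _ => hsum0 i) (Finset.mem_univ j))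
    calc ∫ ω, min 1 (dist (fun j => ∫ x, φ j x ∂(z2PivotalMeasure (εs j) (δs k) ω))
          (fun j => ∫ x, g j n x ∂(z2PivotalMeasure (εs j) (δs k) ω)))
          ∂(bondPercolation (zdGraph 2) half)
        ≤ ∫ ω, 1 / ((n : ℝ) + 1) * ∑ j, ∫ x, χ j x ∂(z2PivotalMeasure (εs j) (δs k) ω)
            ∂(bondPercolation (zdGraph 2) half) :=
          integral_mono (integrable_min_one_dist
            (measurable_pi_lambda _ fun j =>
              measurable_integral_z2PivotalMeasure (hε j) (hpos k) (hφ j) (hφc j))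
            (measurable_pi_lambda _ fun j => measurable_integral_z2PivotalMeasure (hε j) (hpos k)
              (g j n).continuous (g j n).hasCompactSupport))
            ((integrable_finsetSum _ fun j _ => hYi j).const_mul _) hpt
      _ = 1 / ((n : ℝ) + 1) * ∑ j, ∫ ω, ∫ x, χ j x ∂(z2PivotalMeasure (εs j) (δs k) ω)
            ∂(bondPercolation (zdGraph 2) half) := by
          rw [integral_const_mul, integral_finsetSum _ fun j _ => hYi j]
      _ ≤ 1 / ((n : ℝ) + 1) * B := by
          refine mul_le_mul_of_nonneg_left ?_ (by positivity)
          exact Finset.sum_le_sum fun j _ => (hBl j k).trans (le_add_of_nonneg_right (hBm0 j))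
      _ ≤ 1 / ((n : ℝ) + 1) * B + η := le_add_of_nonneg_right hη.le
  · -- limit-side approximation
    have hpt : ∀ S, min 1 (dist (fun j => ∫ x, φ j x ∂(M (εs j) S))
        (fun j => ∫ x, g j n x ∂(M (εs j) S))) ≤
        1 / ((n : ℝ) + 1) * ∑ j, ∫ x, χ j x ∂(M (εs j) S) := fun S => by
      haveI : ∀ j, IsFiniteMeasureOnCompacts (M (εs j) S) := fun j => hMfin _ S
      have hj : ∀ j, |∫ x, φ j x ∂(M (εs j) S) - ∫ x, g j n x ∂(M (εs j) S)| ≤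
          1 / ((n : ℝ) + 1) * ∫ x, χ j x ∂(M (εs j) S) := fun j =>
        abs_integral_sub_le_of_abs_sub_le _ (φc j) (g j n) (χ j) (hφg j n)
      have hsum0 : ∀ j, 0 ≤ 1 / ((n : ℝ) + 1) * ∫ x, χ j x ∂(M (εs j) S) :=
        fun j => mul_nonneg (by positivity) (integral_nonneg fun x => (hχ01 j x).1)
      refine (min_le_right _ _).trans ?_
      rw [Finset.mul_sum]
      refine (dist_pi_le_iff (Finset.sum_nonneg fun j _ => hsum0 j)).2 fun j => ?_
      rw [Real.dist_eq]
      exact (hj j).trans (Finset.single_le_sum (fun i _ => hsum0 i) (Finset.mem_univ j))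
    calc ∫ S, min 1 (dist (fun j => ∫ x, φ j x ∂(M (εs j) S)) (fun j => ∫ x, g j n x ∂(M (εs j) S))) ∂μ
        ≤ ∫ S, 1 / ((n : ℝ) + 1) * ∑ j, ∫ x, χ j x ∂(M (εs j) S) ∂μ :=
          integral_mono (integrable_min_one_dist
            (measurable_pi_lambda _ fun j =>
              measurable_integral_of_measurable_measure (hMm _) (hφ j).stronglyMeasurable)
            (measurable_pi_lambda _ fun j => measurable_integral_of_measurable_measure (hMm _)
              (g j n).continuous.stronglyMeasurable))
            ((integrable_finsetSum _ fun j _ => hZ j).const_mul _) hpt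
      _ = 1 / ((n : ℝ) + 1) * ∑ j, ∫ S, ∫ x, χ j x ∂(M (εs j) S) ∂μ := by
          rw [integral_const_mul, integral_finsetSum _ fun j _ => hZ j]
      _ ≤ 1 / ((n : ℝ) + 1) * B := by
          refine mul_le_mul_of_nonneg_left ?_ (by positivity)
          exact Finset.sum_le_sum fun j _ => le_add_of_nonneg_left (hBl0 j)

end Literature.Probability.Percolation

end
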